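import Summits.NavierStokesRegularity.FluidComputer.RotorKnobNecessity
import Summits.NavierStokesRegularity.FluidComputer.GateBudgetDose
import HarnessLib

/-!
# What no tuning can beat, part 14: THE CARRIER PHASE TRACKS THE DOSE — in the frame co-rotating
# with the rotor the carrier `(a,d)` drifts at speed `≤ ε + ρ²e^{-M} + Kã`, so the sign of the
# transfer mode `d` at clock death is the sign of `sin Φ`, `Φ = (dose since entry)/ρ² ≈ π/(σM)`

Cell `pub-fluidc`, blueprint seat bp1 (gen 28); same namespace and conventions as parts 1–13
(`GateBudget*.lean`); imports `RotorKnob`/`RotorKnobNecessity` (the two-scale family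
`rotorCircuit K M ε ρ`: CLOCK pump `ε : a → b`, SEED pump `ρ²e^{-M} : a → c`, TRIGGER
amplifier `ε⁻¹M : b ⇒ c`, ROTOR `ρ⁻² : c ∘ (a,d)`, DRAIN `K : d → ã`; modes `0 = a` input,
`1 = b` clock, `2 = c` catalyst, `3 = d` transfer, `4 = ã` output; started EXACTLY at (5.6)
`delayInit`; `rotorCircuit_eq_fiveGate`) and part 6 (`GateBudgetDose`: the dose laws).
HONEST FRAMING (verbatim): low prior, high value-of-information experiment on Tao's machine
paradigm; NOT a claim that NS blows up. Nothing is proved about the Navier–Stokes equations.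

## What this part records (SPEC-INPUT-bp1 §V/§W, the single-trajectory half of S13″c (iii):
## WHERE the carrier phase ends at clock death; the selection across the knob is part 15)

Part 6 says the catalyst's DOSE `∫c` over the pulse is fixed by the clock pair's half turn, part 12
(`knob_fired_necessity`) says a fired member must EXIT the pulse with its carrier in quadrature.
The missing link is typed here with NO angle variable and NO new integral: for ANY primitive `C`
of the catalyst (`C' = c`; one exists, `exists_catalyst_primitive`) put `Φ(t) := (C t - C s₀)/ρ²`
and read the carrier in the CO-ROTATING FRAME `p := cos Φ·a + sin Φ·d`, `q := cos Φ·d - sin Φ·a`.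

* §42 THE ROTOR DISAPPEARS (`hasDerivAt_corot_p`, `hasDerivAt_corot_q`): along every trajectory
  `ṗ = -(cos Φ (εab + ρ²e^{-M}ac) + sin Φ · Kdã)`, `q̇ = sin Φ (εab + ρ²e^{-M}ac) - cos Φ · Kdã`:
  the `ρ⁻²`-fast rotor terms cancel identically; what is left is the two slow pumps acting on
  `a` and the drain acting on `d`, of size `≤ ε + ρ²e^{-M} + K|ã|` on the unit sphere
  (`corot_speed_le`) — the drain's share is carried by the output ALREADY DRAINED.
* §43 THE PHASE-TRACKING LAW (`corot_p_drift`, `corot_q_drift`, `knob_phase_tracking_d`,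
  `knob_phase_tracking_a`): for `0 ≤ s₀ ≤ T`, with `L_T := ε + ρ²e^{-M} + K·ã(T)` (output
  monotone), `|p(T) - a(s₀)|, |q(T) - d(s₀)| ≤ L_T (T - s₀)` (mean value inequality), hence
  `|d(T) - (sin Φ(T)·a(s₀) + cos Φ(T)·d(s₀))| ≤ 2L_T(T - s₀)` and
  `|a(T) - (cos Φ(T)·a(s₀) - sin Φ(T)·d(s₀))| ≤ 2L_T(T - s₀)`:
  THE CARRIER AT TIME `T` IS THE ENTRY CARRIER TURNED BY `Φ(T)`, up to the slow drift
  (`L_T ≤ 2ε + K`, `knob_rate_le`; for a member that has not fired by `T`, `Kã(T)` is small).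
* §44 HOW LARGE `Φ` IS (`knob_dose_phase`, part 6 read on the knob family): on a window where the
  catalyst is alive and the clock pair has radius `≥ ϱ`, `(M/ε)ρ²Φ(T) ≥ Δ - ρ²e^{-M}(T-s₀)/ϱ` and
  `(M/ε - ε/ϱ²)ρ²Φ(T) ≤ Δ + ρ²e^{-M}(T-s₀)/ϱ`, `Δ = arctan(b/c)(s₀) - arctan(b/c)(T) < π`:
  `Φ(T) ≈ Δ/(σ_knob M)`, `σ_knob = ρ²/ε` — HALVING THE KNOB DOUBLES THE EXIT PHASE.
* §45 THE TRANSFER-SIGN LAW (`knob_transfer_band`, `knob_transfer_pos`, `knob_transfer_neg`):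
  `sin Φ(T)·a(s₀) - |d(s₀)| - 2L_T(T-s₀) ≤ d(T) ≤ sin Φ(T)·a(s₀) + |d(s₀)| + 2L_T(T-s₀)`; so the
  SIGN of the transfer mode at `T` is the sign of `sin Φ(T)` whenever
  `|sin Φ(T)|·a(s₀) > |d(s₀)| + 2L_T(T - s₀)`. Which side of the input axis a member's carrier
  ends on is decided by its dose phase modulo `π`, and by §44 that phase DOUBLES across a dyadic
  knob window: for `σ_knob M ≲ 1` the sign of `d(T;·)` changes inside the window — the anchors
  of part 15's dud theorem (`knob_dud_of_opposite_phases`).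

TOY (kit j096188, `code/bp1-num/pulse_toy_phaselock.py` + hub-side `anchor_check.py`, data
`pub-fluidc-bp1/data/g28-toy/`; ε = 10⁻², (K,M) ∈ {(10,200),(10,400),(20,400),(40,400)}, 161
knobs σ_knob ∈ [2.5·10⁻⁴, 2.5·10⁻²] per family, read in 552 dyadic windows at the common time
`T` of part 15 (every clock dead, every catalyst `≤ 10⁻²M`), 13 796 member readings;
illustration only, no interval arithmetic): (T1) tracking error
`|(a,d)(T) - R(Φ)(a,d)(s₀)| ≤ 0.25`, at most `0.163` of the bound `2L_T(T - s₀)`; (T2) the sign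
of `sin Φ(T)` equals the sign of `d(T)` in 13 796/13 796 readings, and the law's margin
`|sin Φ|a(s₀) - |d(s₀)| - 2L_T(T-s₀)` is positive in 10 864 of them (3 004 with the crude
constant `ε + K`; none for `K = 40`, where `K(T - s₀) ≈ 1.2`); (T3) the knob-form half-turn law
at clock death: `σ_knob·M·Φ(T)/π ∈ [0.992, 1.001]` in ALL readings, so the sign of `d(T;σ)` is
that of `sin(π/(σ_knob M))` and flips exactly at `σ_knob M = 1/k`, `k = 1, 2, …`.

HONEST LIMITS. Inequalities along ONE exact trajectory from (5.6), for `ε, K ≥ 0` (`ε, ρ > 0` in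
§44), every `M`, every primitive `C`; the drift constant uses `|a|,|b|,|c|,|d| ≤ 1` and the
output level at the END of the interval (no use of `|b| ≲ ε` during the pulse: the toy's slack
`×6`); §44 carries part 6's window hypotheses (`c > 0`, `b² + c² ≥ ϱ²`) undischarged, and `Δ`
is NOT shown to be close to `π` here (that needs armed-at-entry / dead-at-exit levels: S13″c
(iii) proper); nothing selects a knob (part 15), nothing is claimed about the cascade or about
Navier–Stokes; `0` named facts, `0` sorry.
[cite: Tao2016AveragedNS, §5.5 Theorem 5.3, (5.5), (5.6), (b-eq), (energy-con), (est)]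
-/

noncomputable section

namespace Summit.NavierStokesRegularity.FluidComputer.GateBudget

open Real Set Filter Topology
open Literature.Analysis.FluidPDE.Tao2016AveragedNS

variable {K M ε ρ : ℝ} {X : ℝ → Fin 5 → ℝ} {C : ℝ → ℝ}

/-! ## §42 The co-rotating carrier frame: the rotor disappears -/

/-- The slow speed on the unit sphere: for `|u|, |v| ≤ 1` (a cosine and a sine) and modes of
modulus `≤ 1`, `|u(εab + σac) + v·Kde| ≤ ε + σ + K|e|` (`ε, σ, K ≥ 0`): the drain's share of the
drift is carried by the output `e = ã` already drained. [folklore] -/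
theorem corot_speed_le {u v a b c d e ε σ K : ℝ} (hu : |u| ≤ 1) (hv : |v| ≤ 1) (hε : 0 ≤ ε)
    (hσ : 0 ≤ σ) (hK : 0 ≤ K) (ha : |a| ≤ 1) (hb : |b| ≤ 1) (hc : |c| ≤ 1) (hd : |d| ≤ 1) :
    |u * (ε * a * b + σ * a * c) + v * (K * d * e)| ≤ ε + σ + K * |e| := by
  have hab : |a| * |b| ≤ 1 := mul_le_one₀ ha (abs_nonneg b) hb
  have hac : |a| * |c| ≤ 1 := mul_le_one₀ ha (abs_nonneg c) hc
  have hde : |d| * |e| ≤ 1 * |e| := mul_le_mul_of_nonneg_right hd (abs_nonneg e)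
  have hA : |ε * a * b + σ * a * c| ≤ ε + σ := by
    calc |ε * a * b + σ * a * c| ≤ |ε * a * b| + |σ * a * c| := abs_add_le _ _
      _ = ε * (|a| * |b|) + σ * (|a| * |c|) := by
          rw [abs_mul, abs_mul, abs_mul, abs_mul, abs_of_nonneg hε, abs_of_nonneg hσ]; ring
      _ ≤ ε * 1 + σ * 1 := by gcongr
      _ = ε + σ := by ring
  have hB : |K * d * e| ≤ K * |e| := by
    calc |K * d * e| = K * (|d| * |e|) := by rw [abs_mul, abs_mul, abs_of_nonneg hK]; ring
      _ ≤ K * (1 * |e|) := by gcongr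
      _ = K * |e| := by ring
  calc |u * (ε * a * b + σ * a * c) + v * (K * d * e)|
      ≤ |u * (ε * a * b + σ * a * c)| + |v * (K * d * e)| := abs_add_le _ _
    _ = |u| * |ε * a * b + σ * a * c| + |v| * |K * d * e| := by rw [abs_mul, abs_mul]
    _ ≤ 1 * (ε + σ) + 1 * (K * |e|) :=
        add_le_add (mul_le_mul hu hA (abs_nonneg _) zero_le_one)
          (mul_le_mul hv hB (abs_nonneg _) zero_le_one)
    _ = ε + σ + K * |e| := by ring

/-- For `ρ² ≤ ε`, `M ≥ 0` and an output level `θ ≤ 1` the slow speed is at most `2ε + K`.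
[cite: Tao2016AveragedNS, §5.5 (5.5)] -/
theorem knob_rate_le (hρε : ρ ^ 2 ≤ ε) (hM : 0 ≤ M) (hK : 0 ≤ K) {θ : ℝ} (hθ : θ ≤ 1) :
    ε + ρ ^ 2 * exp (-M) + K * θ ≤ 2 * ε + K := by
  have h1 : exp (-M) ≤ 1 := exp_le_one_iff.2 (by linarith)
  nlinarith [mul_le_mul hρε h1 (exp_pos (-M)).le (le_trans (sq_nonneg ρ) hρε),
    mul_le_mul_of_nonneg_left hθ hK]

/-- **THE ROTOR DISAPPEARS, `p`.** For any primitive `C` of the catalyst (`C' = c`) and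
`Φ(t) = (C t - C s₀)/ρ²`, the co-rotating input coordinate `p = cos Φ·a + sin Φ·d` obeys
`ṗ = -(cos Φ·(εab + ρ²e^{-M}ac) + sin Φ·Kdã)`: no `ρ⁻²` term survives.
[cite: Tao2016AveragedNS, §5.5 (5.5)] -/
theorem hasDerivAt_corot_p (hX : ∀ t, HasDerivAt X (RotorKnob.rotorCircuit K M ε ρ (X t)) t)
    (hC : ∀ t, HasDerivAt C (X t 2) t) (s₀ t : ℝ) :
    HasDerivAt (fun s => cos ((C s - C s₀) / ρ ^ 2) * X s 0 + sin ((C s - C s₀) / ρ ^ 2) * X s 3)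
      (-(cos ((C t - C s₀) / ρ ^ 2) * (ε * X t 0 * X t 1 + ρ ^ 2 * exp (-M) * X t 0 * X t 2)
        + sin ((C t - C s₀) / ρ ^ 2) * (K * X t 3 * X t 4))) t := by
  have hΦ : HasDerivAt (fun s => (C s - C s₀) / ρ ^ 2) (X t 2 / ρ ^ 2) t :=
    ((hC t).sub_const (C s₀)).div_const (ρ ^ 2)
  refine ((hΦ.cos.mul (RotorKnob.hasDerivAt_a hX t)).add
    (hΦ.sin.mul (RotorKnob.hasDerivAt_d hX t))).congr_deriv ?_
  simp only [div_eq_mul_inv]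
  ring

/-- **THE ROTOR DISAPPEARS, `q`.** The co-rotating transfer coordinate `q = cos Φ·d - sin Φ·a`
obeys `q̇ = sin Φ·(εab + ρ²e^{-M}ac) - cos Φ·Kdã`. [cite: Tao2016AveragedNS, §5.5 (5.5)] -/
theorem hasDerivAt_corot_q (hX : ∀ t, HasDerivAt X (RotorKnob.rotorCircuit K M ε ρ (X t)) t)
    (hC : ∀ t, HasDerivAt C (X t 2) t) (s₀ t : ℝ) :
    HasDerivAt (fun s => cos ((C s - C s₀) / ρ ^ 2) * X s 3 - sin ((C s - C s₀) / ρ ^ 2) * X s 0)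
      (sin ((C t - C s₀) / ρ ^ 2) * (ε * X t 0 * X t 1 + ρ ^ 2 * exp (-M) * X t 0 * X t 2)
        + -cos ((C t - C s₀) / ρ ^ 2) * (K * X t 3 * X t 4)) t := by
  have hΦ : HasDerivAt (fun s => (C s - C s₀) / ρ ^ 2) (X t 2 / ρ ^ 2) t :=
    ((hC t).sub_const (C s₀)).div_const (ρ ^ 2)
  refine ((hΦ.cos.mul (RotorKnob.hasDerivAt_d hX t)).sub
    (hΦ.sin.mul (RotorKnob.hasDerivAt_a hX t))).congr_deriv ?_
  simp only [div_eq_mul_inv]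
  ring

/-- A primitive of the catalyst always exists (`C(t) = ∫₀ᵗ c`), so the dose phase `Φ` of this part
is available on every trajectory. [folklore] -/
theorem exists_catalyst_primitive
    (hX : ∀ t, HasDerivAt X (RotorKnob.rotorCircuit K M ε ρ (X t)) t) :
    ∃ C : ℝ → ℝ, ∀ t, HasDerivAt C (X t 2) t :=
  ⟨fun t => intervalIntegral (fun s => X s 2) 0 t MeasureTheory.volume, fun t =>
    ((RotorKnob.continuous_traj hX 2).integral_hasStrictDerivAt 0 t).hasDerivAt⟩

/-! ## §43 The phase-tracking law: the carrier at time `T` is the entry carrier turned by `Φ(T)` -/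

/-- **DRIFT OF `p`.** For `0 ≤ s₀ ≤ T`: `|p(T) - a(s₀)| ≤ (ε + ρ²e^{-M} + Kã(T))(T - s₀)`
(`p(s₀) = a(s₀)`; mean value inequality with `corot_speed_le`, output monotone).
[cite: Tao2016AveragedNS, §5.5 Theorem 5.3, (energy-con), (est)] -/
theorem corot_p_drift (hX : ∀ t, HasDerivAt X (RotorKnob.rotorCircuit K M ε ρ (X t)) t)
    (h0 : X 0 = delayInit) (hC : ∀ t, HasDerivAt C (X t 2) t) (hε : 0 ≤ ε) (hK : 0 ≤ K)
    {s₀ T : ℝ} (hs₀ : 0 ≤ s₀) (hsT : s₀ ≤ T) :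
    |cos ((C T - C s₀) / ρ ^ 2) * X T 0 + sin ((C T - C s₀) / ρ ^ 2) * X T 3 - X s₀ 0|
      ≤ (ε + ρ ^ 2 * exp (-M) + K * X T 4) * (T - s₀) := by
  have hb : ∀ t ∈ Ico s₀ T, ‖-(cos ((C t - C s₀) / ρ ^ 2) * (ε * X t 0 * X t 1
      + ρ ^ 2 * exp (-M) * X t 0 * X t 2) + sin ((C t - C s₀) / ρ ^ 2) * (K * X t 3 * X t 4))‖
      ≤ ε + ρ ^ 2 * exp (-M) + K * X T 4 := fun t ht => by
    rw [Real.norm_eq_abs, abs_neg]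
    have h4 : |X t 4| ≤ X T 4 := by
      rw [abs_of_nonneg (RotorKnob.e_nonneg hX h0 hK (hs₀.trans ht.1))]
      exact RotorKnob.rotorCircuit_output_monotone hK hX ht.2.le
    refine (corot_speed_le (abs_cos_le_one _) (abs_sin_le_one _) hε (by positivity) hK
      (RotorKnob.traj_abs_le_one hX h0 t 0) (RotorKnob.traj_abs_le_one hX h0 t 1)
      (RotorKnob.traj_abs_le_one hX h0 t 2) (RotorKnob.traj_abs_le_one hX h0 t 3)).trans ?_
    linarith [mul_le_mul_of_nonneg_left h4 hK]
  have key := norm_image_sub_le_of_norm_deriv_le_segment'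
    (fun t _ => (hasDerivAt_corot_p hX hC s₀ t).hasDerivWithinAt) hb T (right_mem_Icc.2 hsT)
  simpa only [Real.norm_eq_abs, sub_self, zero_div, cos_zero, sin_zero, one_mul, zero_mul,
    add_zero] using key

/-- **DRIFT OF `q`.** For `0 ≤ s₀ ≤ T`: `|q(T) - d(s₀)| ≤ (ε + ρ²e^{-M} + Kã(T))(T - s₀)`.
[cite: Tao2016AveragedNS, §5.5 Theorem 5.3, (energy-con), (est)] -/
theorem corot_q_drift (hX : ∀ t, HasDerivAt X (RotorKnob.rotorCircuit K M ε ρ (X t)) t)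
    (h0 : X 0 = delayInit) (hC : ∀ t, HasDerivAt C (X t 2) t) (hε : 0 ≤ ε) (hK : 0 ≤ K)
    {s₀ T : ℝ} (hs₀ : 0 ≤ s₀) (hsT : s₀ ≤ T) :
    |cos ((C T - C s₀) / ρ ^ 2) * X T 3 - sin ((C T - C s₀) / ρ ^ 2) * X T 0 - X s₀ 3|
      ≤ (ε + ρ ^ 2 * exp (-M) + K * X T 4) * (T - s₀) := by
  have hb : ∀ t ∈ Ico s₀ T, ‖sin ((C t - C s₀) / ρ ^ 2) * (ε * X t 0 * X t 1
      + ρ ^ 2 * exp (-M) * X t 0 * X t 2) + -cos ((C t - C s₀) / ρ ^ 2) * (K * X t 3 * X t 4)‖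
      ≤ ε + ρ ^ 2 * exp (-M) + K * X T 4 := fun t ht => by
    rw [Real.norm_eq_abs]
    have h4 : |X t 4| ≤ X T 4 := by
      rw [abs_of_nonneg (RotorKnob.e_nonneg hX h0 hK (hs₀.trans ht.1))]
      exact RotorKnob.rotorCircuit_output_monotone hK hX ht.2.le
    refine (corot_speed_le (abs_sin_le_one _) (by simpa only [abs_neg] using abs_cos_le_one _)
      hε (by positivity) hK (RotorKnob.traj_abs_le_one hX h0 t 0)
      (RotorKnob.traj_abs_le_one hX h0 t 1) (RotorKnob.traj_abs_le_one hX h0 t 2)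
      (RotorKnob.traj_abs_le_one hX h0 t 3)).trans ?_
    linarith [mul_le_mul_of_nonneg_left h4 hK]
  have key := norm_image_sub_le_of_norm_deriv_le_segment'
    (fun t _ => (hasDerivAt_corot_q hX hC s₀ t).hasDerivWithinAt) hb T (right_mem_Icc.2 hsT)
  simpa only [Real.norm_eq_abs, sub_self, zero_div, cos_zero, sin_zero, one_mul, zero_mul,
    sub_zero] using key

/-- **THE PHASE-TRACKING LAW, transfer mode.** For `0 ≤ s₀ ≤ T` and `Φ = (C T - C s₀)/ρ²`:
`|d(T) - (sin Φ·a(s₀) + cos Φ·d(s₀))| ≤ 2(ε + ρ²e^{-M} + Kã(T))(T - s₀)` — the transfer mode at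
`T` is the entry carrier turned by the dose phase `Φ`, up to the slow drift.
[cite: Tao2016AveragedNS, §5.5 Theorem 5.3, (5.5), (energy-con)] -/
theorem knob_phase_tracking_d (hX : ∀ t, HasDerivAt X (RotorKnob.rotorCircuit K M ε ρ (X t)) t)
    (h0 : X 0 = delayInit) (hC : ∀ t, HasDerivAt C (X t 2) t) (hε : 0 ≤ ε) (hK : 0 ≤ K)
    {s₀ T : ℝ} (hs₀ : 0 ≤ s₀) (hsT : s₀ ≤ T) :
    |X T 3 - (sin ((C T - C s₀) / ρ ^ 2) * X s₀ 0 + cos ((C T - C s₀) / ρ ^ 2) * X s₀ 3)|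
      ≤ 2 * ((ε + ρ ^ 2 * exp (-M) + K * X T 4) * (T - s₀)) := by
  set Φ := (C T - C s₀) / ρ ^ 2 with hΦ
  have hp := corot_p_drift hX h0 hC hε hK hs₀ hsT
  have hq := corot_q_drift hX h0 hC hε hK hs₀ hsT
  rw [← hΦ] at hp hq
  have hid : X T 3 - (sin Φ * X s₀ 0 + cos Φ * X s₀ 3)
      = sin Φ * (cos Φ * X T 0 + sin Φ * X T 3 - X s₀ 0)
        + cos Φ * (cos Φ * X T 3 - sin Φ * X T 0 - X s₀ 3) := by
    linear_combination (-(X T 3)) * sin_sq_add_cos_sq Φ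
  rw [hid]
  calc |sin Φ * (cos Φ * X T 0 + sin Φ * X T 3 - X s₀ 0)
        + cos Φ * (cos Φ * X T 3 - sin Φ * X T 0 - X s₀ 3)|
      ≤ |sin Φ * (cos Φ * X T 0 + sin Φ * X T 3 - X s₀ 0)|
        + |cos Φ * (cos Φ * X T 3 - sin Φ * X T 0 - X s₀ 3)| := abs_add_le _ _
    _ = |sin Φ| * |cos Φ * X T 0 + sin Φ * X T 3 - X s₀ 0|
        + |cos Φ| * |cos Φ * X T 3 - sin Φ * X T 0 - X s₀ 3| := by rw [abs_mul, abs_mul]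
    _ ≤ 1 * ((ε + ρ ^ 2 * exp (-M) + K * X T 4) * (T - s₀))
        + 1 * ((ε + ρ ^ 2 * exp (-M) + K * X T 4) * (T - s₀)) :=
        add_le_add (mul_le_mul (abs_sin_le_one Φ) hp (abs_nonneg _) zero_le_one)
          (mul_le_mul (abs_cos_le_one Φ) hq (abs_nonneg _) zero_le_one)
    _ = 2 * ((ε + ρ ^ 2 * exp (-M) + K * X T 4) * (T - s₀)) := by ring

/-- **THE PHASE-TRACKING LAW, input mode.** For `0 ≤ s₀ ≤ T` and `Φ = (C T - C s₀)/ρ²`: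
`|a(T) - (cos Φ·a(s₀) - sin Φ·d(s₀))| ≤ 2(ε + ρ²e^{-M} + Kã(T))(T - s₀)`.
[cite: Tao2016AveragedNS, §5.5 Theorem 5.3, (5.5), (energy-con)] -/
theorem knob_phase_tracking_a (hX : ∀ t, HasDerivAt X (RotorKnob.rotorCircuit K M ε ρ (X t)) t)
    (h0 : X 0 = delayInit) (hC : ∀ t, HasDerivAt C (X t 2) t) (hε : 0 ≤ ε) (hK : 0 ≤ K)
    {s₀ T : ℝ} (hs₀ : 0 ≤ s₀) (hsT : s₀ ≤ T) :
    |X T 0 - (cos ((C T - C s₀) / ρ ^ 2) * X s₀ 0 - sin ((C T - C s₀) / ρ ^ 2) * X s₀ 3)|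
      ≤ 2 * ((ε + ρ ^ 2 * exp (-M) + K * X T 4) * (T - s₀)) := by
  set Φ := (C T - C s₀) / ρ ^ 2 with hΦ
  have hp := corot_p_drift hX h0 hC hε hK hs₀ hsT
  have hq := corot_q_drift hX h0 hC hε hK hs₀ hsT
  rw [← hΦ] at hp hq
  have hid : X T 0 - (cos Φ * X s₀ 0 - sin Φ * X s₀ 3)
      = cos Φ * (cos Φ * X T 0 + sin Φ * X T 3 - X s₀ 0)
        - sin Φ * (cos Φ * X T 3 - sin Φ * X T 0 - X s₀ 3) := by
    linear_combination (-(X T 0)) * sin_sq_add_cos_sq Φ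
  rw [hid]
  calc |cos Φ * (cos Φ * X T 0 + sin Φ * X T 3 - X s₀ 0)
        - sin Φ * (cos Φ * X T 3 - sin Φ * X T 0 - X s₀ 3)|
      ≤ |cos Φ * (cos Φ * X T 0 + sin Φ * X T 3 - X s₀ 0)|
        + |sin Φ * (cos Φ * X T 3 - sin Φ * X T 0 - X s₀ 3)| := abs_sub _ _
    _ = |cos Φ| * |cos Φ * X T 0 + sin Φ * X T 3 - X s₀ 0|
        + |sin Φ| * |cos Φ * X T 3 - sin Φ * X T 0 - X s₀ 3| := by rw [abs_mul, abs_mul]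
    _ ≤ 1 * ((ε + ρ ^ 2 * exp (-M) + K * X T 4) * (T - s₀))
        + 1 * ((ε + ρ ^ 2 * exp (-M) + K * X T 4) * (T - s₀)) :=
        add_le_add (mul_le_mul (abs_cos_le_one Φ) hp (abs_nonneg _) zero_le_one)
          (mul_le_mul (abs_sin_le_one Φ) hq (abs_nonneg _) zero_le_one)
    _ = 2 * ((ε + ρ ^ 2 * exp (-M) + K * X T 4) * (T - s₀)) := by ring

/-! ## §44 How large `Φ` is: the dose phase in knob form (part 6 on the knob family) -/

/-- **THE DOSE PHASE.** On a window `[s₀, T]` on which the catalyst is alive (`c > 0`) and the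
clock pair has radius `≥ ϱ > 0`, for any primitive `C` of `c`, the dose phase `Φ = (C T - C s₀)/ρ²`
(`ρ > 0`, `ε > 0`) obeys
`Δ - ρ²e^{-M}(T-s₀)/ϱ ≤ (M/ε)·ρ²·Φ` and `(M/ε - ε/ϱ²)·ρ²·Φ ≤ Δ + ρ²e^{-M}(T-s₀)/ϱ`,
`Δ := arctan(b(s₀)/c(s₀)) - arctan(b(T)/c(T)) < π`: `Φ ≈ εΔ/(Mρ²) = Δ/(σ_knob M)` — part 6's dose
laws (`dose_law`, `dose_law_lower`) read on the knob family (`rotorCircuit_eq_fiveGate`).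
[cite: Tao2016AveragedNS, §5.5 Theorem 5.3, (5.5), (b-eq)] -/
theorem knob_dose_phase (hX : ∀ t, HasDerivAt X (RotorKnob.rotorCircuit K M ε ρ (X t)) t)
    (h0 : X 0 = delayInit) (hε : 0 < ε) (hρ : 0 < ρ) (hC : ∀ t, HasDerivAt C (X t 2) t)
    {s₀ T ϱ : ℝ} (hsT : s₀ ≤ T) (hϱ : 0 < ϱ) (hc : ∀ t ∈ Icc s₀ T, 0 < X t 2)
    (hr : ∀ t ∈ Icc s₀ T, ϱ ^ 2 ≤ X t 1 ^ 2 + X t 2 ^ 2) :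
    arctan (X s₀ 1 / X s₀ 2) - arctan (X T 1 / X T 2) - ρ ^ 2 * exp (-M) * (T - s₀) / ϱ
        ≤ ε⁻¹ * M * (ρ ^ 2 * ((C T - C s₀) / ρ ^ 2)) ∧
      (ε⁻¹ * M - ε / ϱ ^ 2) * (ρ ^ 2 * ((C T - C s₀) / ρ ^ 2))
        ≤ arctan (X s₀ 1 / X s₀ 2) - arctan (X T 1 / X T 2)
          + ρ ^ 2 * exp (-M) * (T - s₀) / ϱ := by
  rw [RotorKnob.rotorCircuit_eq_fiveGate] at hX
  rw [mul_div_cancel₀ _ (pow_pos hρ 2).ne']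
  exact ⟨dose_law_lower hX h0 hε.le (by positivity) hsT hϱ hc hr fun t _ => hC t,
    dose_law hX h0 hε.le (by positivity) hsT hϱ hc hr fun t _ => hC t⟩

/-! ## §45 The transfer-sign law: which side of the input axis the carrier ends on -/

/-- **THE TRANSFER BAND.** For `0 ≤ s₀ ≤ T`, `Φ = (C T - C s₀)/ρ²`, `L_T = ε + ρ²e^{-M} + Kã(T)`:
`sin Φ·a(s₀) - |d(s₀)| - 2L_T(T-s₀) ≤ d(T) ≤ sin Φ·a(s₀) + |d(s₀)| + 2L_T(T-s₀)`.
[cite: Tao2016AveragedNS, §5.5 Theorem 5.3, (5.5)] -/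
theorem knob_transfer_band (hX : ∀ t, HasDerivAt X (RotorKnob.rotorCircuit K M ε ρ (X t)) t)
    (h0 : X 0 = delayInit) (hC : ∀ t, HasDerivAt C (X t 2) t) (hε : 0 ≤ ε) (hK : 0 ≤ K)
    {s₀ T : ℝ} (hs₀ : 0 ≤ s₀) (hsT : s₀ ≤ T) :
    sin ((C T - C s₀) / ρ ^ 2) * X s₀ 0 - |X s₀ 3|
        - 2 * ((ε + ρ ^ 2 * exp (-M) + K * X T 4) * (T - s₀)) ≤ X T 3 ∧
      X T 3 ≤ sin ((C T - C s₀) / ρ ^ 2) * X s₀ 0 + |X s₀ 3|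
        + 2 * ((ε + ρ ^ 2 * exp (-M) + K * X T 4) * (T - s₀)) := by
  have h := abs_le.1 (knob_phase_tracking_d hX h0 hC hε hK hs₀ hsT)
  have hcd : |cos ((C T - C s₀) / ρ ^ 2) * X s₀ 3| ≤ |X s₀ 3| := by
    rw [abs_mul]
    exact mul_le_of_le_one_left (abs_nonneg _) (abs_cos_le_one _)
  have h1 := neg_abs_le (cos ((C T - C s₀) / ρ ^ 2) * X s₀ 3)
  have h2 := le_abs_self (cos ((C T - C s₀) / ρ ^ 2) * X s₀ 3)
  constructor <;> linarith [h.1, h.2]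

/-- **POSITIVE TRANSFER.** If `sin Φ·a(s₀) > |d(s₀)| + 2L_T(T - s₀)` then `d(T) > 0`.
[cite: Tao2016AveragedNS, §5.5 Theorem 5.3, (5.5)] -/
theorem knob_transfer_pos (hX : ∀ t, HasDerivAt X (RotorKnob.rotorCircuit K M ε ρ (X t)) t)
    (h0 : X 0 = delayInit) (hC : ∀ t, HasDerivAt C (X t 2) t) (hε : 0 ≤ ε) (hK : 0 ≤ K)
    {s₀ T : ℝ} (hs₀ : 0 ≤ s₀) (hsT : s₀ ≤ T)
    (h : |X s₀ 3| + 2 * ((ε + ρ ^ 2 * exp (-M) + K * X T 4) * (T - s₀))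
      < sin ((C T - C s₀) / ρ ^ 2) * X s₀ 0) : 0 < X T 3 := by
  have hb := (knob_transfer_band hX h0 hC hε hK hs₀ hsT).1
  linarith

/-- **NEGATIVE TRANSFER.** If `sin Φ·a(s₀) < -(|d(s₀)| + 2L_T(T - s₀))` then `d(T) < 0`.
[cite: Tao2016AveragedNS, §5.5 Theorem 5.3, (5.5)] -/
theorem knob_transfer_neg (hX : ∀ t, HasDerivAt X (RotorKnob.rotorCircuit K M ε ρ (X t)) t)
    (h0 : X 0 = delayInit) (hC : ∀ t, HasDerivAt C (X t 2) t) (hε : 0 ≤ ε) (hK : 0 ≤ K)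
    {s₀ T : ℝ} (hs₀ : 0 ≤ s₀) (hsT : s₀ ≤ T)
    (h : sin ((C T - C s₀) / ρ ^ 2) * X s₀ 0
      < -(|X s₀ 3| + 2 * ((ε + ρ ^ 2 * exp (-M) + K * X T 4) * (T - s₀)))) : X T 3 < 0 := by
  have hb := (knob_transfer_band hX h0 hC hε hK hs₀ hsT).2
  linarith

end Summit.NavierStokesRegularity.FluidComputer.GateBudget
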